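import Mathlib.GroupTheory.PresentedGroup
import Mathlib.GroupTheory.OrderOfElement
import Mathlib.GroupTheory.Index
import Mathlib.Data.ZMod.Basic
import Mathlib.Algebra.Group.Subgroup.Pointwise
import Mathlib.Algebra.Group.Subgroup.Finite
import Mathlib.Algebra.Group.TypeTags.Finite
import Mathlib.GroupTheory.GroupAction.ConjAct
import Literature.GroupTheory.CombinatorialGroupTheory.PuncturedSurfaceGroupCuspQuotients
import HarnessLib

/-!
# Finite quotients of `Γ_{g,r}` with uniform cusp order AND a subgroup avoiding the cusp groups

For [SemiAnbd] Example 2.10's "totally elevated" (Def. 2.4 (i): for every `M` a finite quotient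
`Π_v ↠ Π'_v` — part of a `π₁`-epimorphic approximator, so with the SAME order `n` of every cusp
image as at the neighbouring vertices — together with a subgroup `N ⊆ Π'_v` of order `≥ M` meeting
every conjugate of every cusp image group trivially) [cite: MochizukiSemiAnbd2006, Ex. 2.10 p.31],
this proof-only file (cell abc-iut, layer L3, row G31 (2), seat abc-iut-L3-t4) supplies the group
theory for the hyperbolic types `(g, r)` with `g ≥ 1` or `r ≥ 4`: for a prime `p` and `k : ℕ`, a
homomorphism `f : Γ_{g,r} → Q` to a finite group of `p`-power order with every `f(c_j)` of order
exactly `p ^ (k+1)` and a subgroup `N ⊆ f(Γ)` of order `≥ p ^ k` with `N ∩ q⟨f(c_j)⟩q⁻¹ = 1` for all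
`q ∈ Q` and all `j` (`exists_hom_cuspOrder_avoiding_of_pos_genus`, `…_of_four_le`).  Method:
`f = (f₁, f₂)` with `f₁` the uniform cusp-order quotient of `PuncturedSurfaceGroupCuspQuotients.lean`
and `f₂` a large ABELIAN quotient whose cusp images are killed by `p ^ (k+1)`;
`N = {1} × f₂(Ker f₁)` (`avoiding_inf_eq_bot`: a subgroup of `Ker π` avoids the conjugates of `⟨x⟩`
as soon as `π` preserves the order of `x`).  The type `(0, 3)` needs a nonabelian target and is
treated separately.  Theorems only; no statement here takes a side on any disputed claim.
-/

namespace Literature.GroupTheory.CombinatorialGroupTheory.PuncturedSurfaceGroup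

open Multiplicative
open scoped Pointwise

variable {g r : ℕ}

/-! ### Generic lemmas -/

/-- If `N ⊆ Ker π` and `π` preserves the order of `x`, then `N` meets every conjugate of `⟨x⟩`
trivially. [cite: MochizukiSemiAnbd2006, Ex. 2.10 p.31] -/
theorem avoiding_inf_eq_bot {Q A : Type*} [Group Q] [Group A] (π : Q →* A) (N : Subgroup Q)
    (hN : N ≤ π.ker) (x : Q) (hx : orderOf (π x) = orderOf x) (q : Q) :
    N ⊓ ConjAct.toConjAct q • Subgroup.zpowers x = ⊥ := by
  rw [eq_bot_iff]
  intro y hy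
  obtain ⟨hyN, hyC⟩ := Subgroup.mem_inf.1 hy
  obtain ⟨_, ⟨t, rfl⟩, rfl⟩ := (Subgroup.mem_smul_pointwise_iff_exists _ _ _).1 hyC
  rw [Subgroup.mem_bot]
  have hy' : ConjAct.toConjAct q • ((fun i : ℤ => x ^ i) t) = q * x ^ t * q⁻¹ := by
    simp [ConjAct.smul_def]
  rw [hy'] at hyN ⊢
  have hker := (MonoidHom.mem_ker).1 (hN hyN)
  rw [map_mul, map_mul, map_inv, map_zpow, mul_inv_eq_one, mul_eq_left] at hker
  have h3 : x ^ t = 1 := by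
    rw [← orderOf_dvd_iff_zpow_eq_one] at hker ⊢
    rwa [← hx]
  rw [h3, mul_one, mul_inv_cancel]

/-- **The product trick.** `f₁ : Γ → A` with every cusp image of order exactly `n`, `f₂ : Γ → B`
with every cusp image killed by `n`; then `f = (f₁, f₂)` has cusp images of order exactly `n`, and
`N = {1} × f₂(Ker f₁) ⊆ f(Γ)` meets every conjugate of every `⟨f(c_j)⟩` trivially and satisfies
`|f₂(Γ)| ≤ |N| · |A|`. [cite: MochizukiSemiAnbd2006, Ex. 2.10 p.31] -/
theorem prod_trick {A B : Type*} [Group A] [Group B] [Finite A] [Finite B]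
    (f₁ : PuncturedSurfaceGroup g r →* A) (f₂ : PuncturedSurfaceGroup g r →* B) {n : ℕ}
    (hord : ∀ j, orderOf (f₁ (c j)) = n) (hpow : ∀ j, f₂ (c j) ^ n = 1) :
    (∀ j, orderOf ((f₁.prod f₂) (c j)) = n) ∧
    ∃ N : Subgroup (A × B), N ≤ (f₁.prod f₂).range ∧ Nat.card f₂.range ≤ Nat.card N * Nat.card A ∧
      ∀ (j : Fin r) (q : A × B),
        N ⊓ ConjAct.toConjAct q • Subgroup.zpowers ((f₁.prod f₂) (c j)) = ⊥ := by
  classical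
  have hordf : ∀ j, orderOf ((f₁.prod f₂) (c j)) = n := by
    intro j
    rw [MonoidHom.prod_apply, Prod.orderOf, hord j]
    exact Nat.dvd_antisymm (Nat.lcm_dvd (dvd_refl n) (orderOf_dvd_of_pow_eq_one (hpow j)))
      (Nat.dvd_lcm_left _ _)
  refine ⟨hordf, (f₁.ker.map f₂).map (MonoidHom.inr A B), ?_, ?_, fun j q => ?_⟩
  · rintro _ ⟨_, ⟨γ, hγ, rfl⟩, rfl⟩
    refine ⟨γ, ?_⟩
    rw [MonoidHom.prod_apply, (MonoidHom.mem_ker).1 hγ]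
    rfl
  · -- `|f₂(Γ)| = [f₂(Γ) : f₂(K)] · |f₂(K)|` and `[f₂(Γ) : f₂(K)] ∣ [Γ : K] = |f₁(Γ)| ≤ |A|`
    have h1 : Nat.card ((f₁.ker.map f₂).map (MonoidHom.inr A B)) = Nat.card (f₁.ker.map f₂) :=
      Subgroup.card_map_of_injective (fun x y h => (Prod.mk.inj h).2)
    have h2 : Nat.card (f₁.ker.map f₂) = Nat.card (f₁.ker.map f₂.rangeRestrict) := by
      rw [← Subgroup.card_map_of_injective (K := f₁.ker.map f₂.rangeRestrict)
        f₂.range.subtype_injective, Subgroup.map_map]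
      rfl
    have h3 : Nat.card (f₁.ker.map f₂.rangeRestrict) * (f₁.ker.map f₂.rangeRestrict).index =
        Nat.card f₂.range := Subgroup.card_mul_index _
    have h4 : (f₁.ker.map f₂.rangeRestrict).index ∣ f₁.ker.index :=
      f₁.ker.index_map_dvd f₂.rangeRestrict_surjective
    have h5 : f₁.ker.index ≤ Nat.card A := by
      rw [Subgroup.index_ker]
      exact Nat.card_le_card_of_injective _ f₁.range.subtype_injective
    haveI : f₁.ker.FiniteIndex := by
      rw [Subgroup.finiteIndex_iff, Subgroup.index_ker]
      exact Nat.card_pos.ne'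
    have h6 : (f₁.ker.map f₂.rangeRestrict).index ≤ Nat.card A :=
      (Nat.le_of_dvd (Nat.pos_of_ne_zero Subgroup.FiniteIndex.index_ne_zero) h4).trans h5
    rw [h1, h2, ← h3]
    exact Nat.mul_le_mul_left _ h6
  · refine avoiding_inf_eq_bot (MonoidHom.fst A B) _ ?_ _ ?_ q
    · rintro _ ⟨x, -, rfl⟩
      exact (MonoidHom.mem_ker).2 rfl
    · rw [hordf j, MonoidHom.prod_apply]
      exact hord j

/-! ### The uniform cusp-order quotient, packaged -/

/-- The uniform cusp-order quotient of `PuncturedSurfaceGroupCuspQuotients.lean` as a homomorphism to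
SOME finite group of order dividing `n ^ 3`. [cite: MochizukiSemiAnbd2006, Ex. 2.10 p.31] -/
theorem exists_hom_cuspOrder (h : IsHyperbolicType g r) {n : ℕ} (hn : 0 < n) :
    ∃ (A : Type) (_ : Group A) (_ : Finite A) (f : PuncturedSurfaceGroup g r →* A),
      Nat.card A ∣ n ^ 3 ∧ ∀ j, orderOf (f (c j)) = n := by
  haveI : NeZero n := ⟨hn.ne'⟩
  have hcZ : Nat.card (Multiplicative (ZMod n)) = n := by
    rw [Nat.card_congr Multiplicative.toAdd, Nat.card_zmod]
  have hcZ2 : Nat.card (Multiplicative (ZMod n × ZMod n)) = n ^ 2 := by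
    rw [Nat.card_congr Multiplicative.toAdd, Nat.card_prod, Nat.card_zmod, sq]
  obtain ⟨k, hk | hk⟩ := Nat.even_or_odd' r
  · obtain ⟨f, hf⟩ := exists_hom_of_even (g := g) hk n
    exact ⟨_, inferInstance, inferInstance, f, by rw [hcZ]; exact dvd_pow_self n three_ne_zero, hf⟩
  · rcases Nat.eq_zero_or_pos k with rfl | _
    · subst hk
      have hg : 0 < g := by unfold IsHyperbolicType at h; omega
      obtain ⟨σ, f, hf⟩ := exists_hom_of_one hg n
      haveI : Finite (Multiplicative (ZMod n × ZMod n) ⋊[σ] Multiplicative (ZMod n)) :=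
        Finite.of_equiv _ SemidirectProduct.equivProd.symm
      refine ⟨_, inferInstance, inferInstance, f, dvd_of_eq ?_, hf⟩
      rw [Nat.card_congr SemidirectProduct.equivProd, Nat.card_prod, hcZ2, hcZ]
      ring
    · obtain ⟨k', rfl⟩ : ∃ k', k = k' + 1 := ⟨k - 1, by omega⟩
      obtain ⟨f, hf⟩ := exists_hom_of_odd (g := g) (show r = 2 * k' + 3 by omega) n
      exact ⟨_, inferInstance, inferInstance, f,
        by rw [hcZ2]; exact pow_dvd_pow n (by omega), hf⟩

/-! ### Positive genus: `f₂` through `a₁ ↦ 1 ∈ ℤ/p^a` -/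

/-- For `g ≥ 1`: a homomorphism `Γ_{g,r} → ℤ/N` sending `a₁ ↦ 1` and all other generators to `0`
(surjective, killing the cusp generators). [cite: MochizukiSemiAnbd2006, Ex. 2.10 p.31] -/
theorem exists_hom_a_surjective (hg : 0 < g) (K : ℕ) [NeZero K] :
    ∃ f : PuncturedSurfaceGroup g r →* Multiplicative (ZMod K),
      Function.Surjective f ∧ ∀ j, f (c j) = 1 := by
  let i₀ : Fin g := ⟨0, hg⟩
  let F : puncturedSurfaceGen g r → Multiplicative (ZMod K) :=
    Sum.elim (fun ib => if ib = (i₀, false) then ofAdd 1 else 1) fun _ => 1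
  have hrel : ∀ w ∈ ({relator g r} : Set (FreeGroup (puncturedSurfaceGen g r))),
      FreeGroup.lift F w = 1 := by
    intro w hw
    rw [Set.mem_singleton_iff] at hw
    subst hw
    simp only [relator, map_mul, map_list_prod, List.map_map, Function.comp_def, map_inv, genA, genB,
      genC, FreeGroup.lift_apply_of]
    have h1 : ((List.finRange g).map fun i =>
        F (Sum.inl (i, false)) * F (Sum.inl (i, true)) * (F (Sum.inl (i, false)))⁻¹ *
          (F (Sum.inl (i, true)))⁻¹).prod = 1 :=
      List.prod_eq_one fun y hy => by
        obtain ⟨i, -, rfl⟩ := List.mem_map.mp hy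
        rw [mul_inv_cancel_comm, mul_inv_cancel]
    have h2 : ((List.finRange r).map fun j => F (Sum.inr j)).prod = 1 :=
      List.prod_eq_one fun y hy => by
        obtain ⟨j, -, rfl⟩ := List.mem_map.mp hy
        rfl
    rw [h1, h2, one_mul]
  refine ⟨PresentedGroup.toGroup hrel, fun y => ⟨a i₀ ^ (toAdd y).val, ?_⟩, fun j => ?_⟩
  · rw [map_pow, a, PresentedGroup.toGroup.of]
    change (if ((i₀, false) : Fin g × Bool) = (i₀, false) then ofAdd (1 : ZMod K) else 1) ^ _ = y
    rw [if_pos rfl, ← ofAdd_nsmul, nsmul_eq_mul, mul_one, ZMod.natCast_zmod_val, ofAdd_toAdd]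
  · rw [c, PresentedGroup.toGroup.of]
    rfl

/-- **Positive genus.** For `g ≥ 1`, `(g, r)` hyperbolic, a prime `p` and `k : ℕ`: a homomorphism
`f : Γ_{g,r} → Q` to a finite group of `p`-power order with every `f(c_j)` of order exactly
`p ^ (k+1)` and a subgroup `N ⊆ f(Γ)` of order `≥ p ^ k` avoiding all conjugates of all the
`⟨f(c_j)⟩`. [cite: MochizukiSemiAnbd2006, Ex. 2.10 p.31] -/
theorem exists_hom_cuspOrder_avoiding_of_pos_genus (h : IsHyperbolicType g r) (hg : 0 < g)
    {p : ℕ} (hp : p.Prime) (k : ℕ) :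
    ∃ (Q : Type) (_ : Group Q) (_ : Finite Q) (f : PuncturedSurfaceGroup g r →* Q)
      (N : Subgroup Q), (∃ a, Nat.card Q ∣ p ^ a) ∧ (∀ j, orderOf (f (c j)) = p ^ (k + 1)) ∧
      N ≤ f.range ∧ p ^ k ≤ Nat.card N ∧
      ∀ (j : Fin r) (q : Q), N ⊓ ConjAct.toConjAct q • Subgroup.zpowers (f (c j)) = ⊥ := by
  haveI : NeZero (p ^ (4 * k + 3)) := ⟨pow_ne_zero _ hp.ne_zero⟩
  obtain ⟨A, _, _, f₁, hA, hf₁⟩ := exists_hom_cuspOrder (g := g) h (pow_pos hp.pos (k + 1))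
  obtain ⟨f₂, hf₂s, hf₂c⟩ := exists_hom_a_surjective (r := r) hg (p ^ (4 * k + 3))
  obtain ⟨hord, N, hNle, hNcard, hNav⟩ := prod_trick f₁ f₂ hf₁ (fun j => by rw [hf₂c j, one_pow])
  refine ⟨A × Multiplicative (ZMod (p ^ (4 * k + 3))), inferInstance, inferInstance, f₁.prod f₂, N,
    ⟨(k + 1) * 3 + (4 * k + 3), ?_⟩, hord, hNle, ?_, hNav⟩
  · rw [Nat.card_prod, Nat.card_congr Multiplicative.toAdd, Nat.card_zmod]
    rw [← pow_mul] at hA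
    exact (Nat.mul_dvd_mul hA (dvd_refl (p ^ (4 * k + 3)))).trans (dvd_of_eq (pow_add p _ _).symm)
  · have hr2 : Nat.card f₂.range = p ^ (4 * k + 3) := by
      rw [MonoidHom.range_eq_top_of_surjective _ hf₂s, Subgroup.card_top,
        Nat.card_congr Multiplicative.toAdd, Nat.card_zmod]
    rw [← pow_mul] at hA
    have hA' : Nat.card A ≤ p ^ ((k + 1) * 3) := Nat.le_of_dvd (pow_pos hp.pos _) hA
    rw [hr2] at hNcard
    -- `p^(4k+3) ≤ |N| · |A| ≤ |N| · p^(3k+3)`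
    by_contra hlt
    rw [not_le] at hlt
    have : Nat.card N * Nat.card A < p ^ k * p ^ ((k + 1) * 3) :=
      Nat.mul_lt_mul_of_lt_of_le hlt hA' (pow_pos hp.pos _)
    rw [← pow_add, show k + (k + 1) * 3 = 4 * k + 3 by ring] at this
    exact absurd hNcard (not_le.2 this)

/-! ### At least four cusps: `f₂` through three independent cusp coordinates -/

/-- For distinct cusps `i ≠ i'`: a homomorphism `Γ_{g,r} → ℤ/n` with `c_i ↦ 1`, `c_{i'} ↦ −1` and all
other generators `↦ 0`. [cite: MochizukiSemiAnbd2006, Ex. 2.10 p.31] -/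
theorem exists_hom_pair (i i' : Fin r) (hii : i ≠ i') (n : ℕ) :
    ∃ φ : PuncturedSurfaceGroup g r →* Multiplicative (ZMod n),
      φ (c i) = ofAdd 1 ∧ φ (c i') = (ofAdd 1)⁻¹ ∧ ∀ j, j ≠ i → j ≠ i' → φ (c j) = 1 := by
  classical
  let e : Multiplicative (ZMod n) := ofAdd 1
  let F : puncturedSurfaceGen g r → Multiplicative (ZMod n) :=
    Sum.elim (fun _ => 1) fun j => (if j = i then e else 1) * (if j = i' then e⁻¹ else 1)
  have hrel : ∀ w ∈ ({relator g r} : Set (FreeGroup (puncturedSurfaceGen g r))),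
      FreeGroup.lift F w = 1 := by
    intro w hw
    rw [Set.mem_singleton_iff] at hw
    subst hw
    simp only [relator, map_mul, map_list_prod, List.map_map, Function.comp_def, map_inv, genA, genB,
      genC, FreeGroup.lift_apply_of]
    have h1 : ((List.finRange g).map fun i =>
        F (Sum.inl (i, false)) * F (Sum.inl (i, true)) * (F (Sum.inl (i, false)))⁻¹ *
          (F (Sum.inl (i, true)))⁻¹).prod = 1 :=
      List.prod_eq_one fun y hy => by
        obtain ⟨i, -, rfl⟩ := List.mem_map.mp hy
        simp [F]
    have h2 : ((List.finRange r).map fun j => F (Sum.inr j)).prod = 1 := by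
      rw [← Fin.prod_univ_def]
      simp only [F, Sum.elim_inr]
      rw [Finset.prod_mul_distrib, Finset.prod_ite_eq', Finset.prod_ite_eq']
      simp
    rw [h1, h2, one_mul]
  refine ⟨PresentedGroup.toGroup hrel, ?_, ?_, fun j hj hj' => ?_⟩
  · rw [c, PresentedGroup.toGroup.of]
    change (if i = i then e else 1) * (if i = i' then e⁻¹ else 1) = e
    rw [if_pos rfl, if_neg hii, mul_one]
  · rw [c, PresentedGroup.toGroup.of]
    change (if i' = i then e else 1) * (if i' = i' then e⁻¹ else 1) = e⁻¹
    rw [if_neg (Ne.symm hii), if_pos rfl, one_mul]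
  · rw [c, PresentedGroup.toGroup.of]
    change (if j = i then e else 1) * (if j = i' then e⁻¹ else 1) = 1
    rw [if_neg hj, if_neg hj', one_mul]

/-- For `r ≥ 4`: a homomorphism `f₂ : Γ_{g,r} → (ℤ/n)³` which is SURJECTIVE (`c₀, c₁, c₂ ↦` the three
basis vectors, `c₃ ↦` minus their sum). [cite: MochizukiSemiAnbd2006, Ex. 2.10 p.31] -/
theorem exists_hom_three_surjective (hr : 4 ≤ r) (n : ℕ) [NeZero n] :
    ∃ f₂ : PuncturedSurfaceGroup g r →*
      Multiplicative (ZMod n) × (Multiplicative (ZMod n) × Multiplicative (ZMod n)),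
      Function.Surjective f₂ := by
  let i0 : Fin r := ⟨0, by omega⟩
  let i1 : Fin r := ⟨1, by omega⟩
  let i2 : Fin r := ⟨2, by omega⟩
  let i3 : Fin r := ⟨3, by omega⟩
  obtain ⟨φ0, h0, -, h0'⟩ := exists_hom_pair (g := g) i0 i3 (by simp [i0, i3, Fin.ext_iff]) n
  obtain ⟨φ1, h1, -, h1'⟩ := exists_hom_pair (g := g) i1 i3 (by simp [i1, i3, Fin.ext_iff]) n
  obtain ⟨φ2, h2, -, h2'⟩ := exists_hom_pair (g := g) i2 i3 (by simp [i2, i3, Fin.ext_iff]) n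
  refine ⟨φ0.prod (φ1.prod φ2), fun y => ?_⟩
  refine ⟨c i0 ^ (toAdd y.1).val * c i1 ^ (toAdd y.2.1).val * c i2 ^ (toAdd y.2.2).val, ?_⟩
  have hpow : ∀ z : Multiplicative (ZMod n), (ofAdd (1 : ZMod n)) ^ (toAdd z).val = z := fun z => by
    rw [← ofAdd_nsmul, nsmul_eq_mul, mul_one, ZMod.natCast_zmod_val, ofAdd_toAdd]
  have h01 : i0 ≠ i1 := by simp [i0, i1, Fin.ext_iff]
  have h02 : i0 ≠ i2 := by simp [i0, i2, Fin.ext_iff]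
  have h12 : i1 ≠ i2 := by simp [i1, i2, Fin.ext_iff]
  have h03 : i0 ≠ i3 := by simp [i0, i3, Fin.ext_iff]
  have h13 : i1 ≠ i3 := by simp [i1, i3, Fin.ext_iff]
  have h23 : i2 ≠ i3 := by simp [i2, i3, Fin.ext_iff]
  simp only [map_mul, map_pow, MonoidHom.prod_apply, h0, h1, h2, h0' i1 h01.symm h13,
    h0' i2 h02.symm h23, h1' i0 h01 h03, h1' i2 h12.symm h23, h2' i0 h02 h03, h2' i1 h12 h13,
    Prod.pow_mk, one_pow, mul_one, one_mul, Prod.mk_mul_mk, hpow]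

/-- **At least four cusps.** For `r ≥ 4`, `(g, r)` (automatically hyperbolic), a prime `p` and
`k : ℕ`: a homomorphism `f : Γ_{g,r} → Q` to a finite group of `p`-power order with every `f(c_j)`
of order exactly `p ^ (k+1)` and a subgroup `N ⊆ f(Γ)` of order `≥ p ^ k` avoiding all conjugates
of all the `⟨f(c_j)⟩`. [cite: MochizukiSemiAnbd2006, Ex. 2.10 p.31] -/
theorem exists_hom_cuspOrder_avoiding_of_four_le (hr : 4 ≤ r) {p : ℕ} (hp : p.Prime) (k : ℕ) :
    ∃ (Q : Type) (_ : Group Q) (_ : Finite Q) (f : PuncturedSurfaceGroup g r →* Q)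
      (N : Subgroup Q), (∃ a, Nat.card Q ∣ p ^ a) ∧ (∀ j, orderOf (f (c j)) = p ^ (k + 1)) ∧
      N ≤ f.range ∧ p ^ k ≤ Nat.card N ∧
      ∀ (j : Fin r) (q : Q), N ⊓ ConjAct.toConjAct q • Subgroup.zpowers (f (c j)) = ⊥ := by
  haveI : NeZero (p ^ (k + 1)) := ⟨pow_ne_zero _ hp.ne_zero⟩
  set n := p ^ (k + 1) with hn
  have hcZ : Nat.card (Multiplicative (ZMod n)) = n := by
    rw [Nat.card_congr Multiplicative.toAdd, Nat.card_zmod]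
  have hcZ2 : Nat.card (Multiplicative (ZMod n × ZMod n)) = n ^ 2 := by
    rw [Nat.card_congr Multiplicative.toAdd, Nat.card_prod, Nat.card_zmod, sq]
  have hcZ3 : Nat.card (Multiplicative (ZMod n) × (Multiplicative (ZMod n) × Multiplicative (ZMod n)))
      = n ^ 3 := by
    rw [Nat.card_prod, Nat.card_prod, hcZ]; ring
  obtain ⟨f₂, hf₂⟩ := exists_hom_three_surjective (g := g) hr n
  have hZ : ∀ x : Multiplicative (ZMod n), x ^ n = 1 := fun x => by
    have := pow_card_eq_one' (G := Multiplicative (ZMod n)) (x := x)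
    rwa [hcZ] at this
  have hpow : ∀ j, f₂ (c j) ^ n = 1 := fun j =>
    Prod.ext (hZ _) (Prod.ext (hZ _) (hZ _))
  have hr2 : Nat.card f₂.range = n ^ 3 := by
    rw [MonoidHom.range_eq_top_of_surjective _ hf₂, Subgroup.card_top, hcZ3]
  -- `f₁` of order `n` resp. `n²` according to the parity of `r`
  obtain ⟨k', hk' | hk'⟩ := Nat.even_or_odd' r
  · obtain ⟨f₁, hf₁⟩ := exists_hom_of_even (g := g) hk' n
    obtain ⟨hord, N, hNle, hNcard, hNav⟩ := prod_trick f₁ f₂ hf₁ hpow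
    refine ⟨_, inferInstance, inferInstance, f₁.prod f₂, N, ⟨(k + 1) + (k + 1) * 3, ?_⟩, hord, hNle,
      ?_, hNav⟩
    · rw [Nat.card_prod, hcZ, hcZ3, hn, ← pow_mul, ← pow_add]
    · rw [hr2, hcZ] at hNcard
      by_contra hlt
      rw [not_le] at hlt
      have : Nat.card N * n < p ^ k * n := Nat.mul_lt_mul_of_pos_right hlt (pow_pos hp.pos _)
      have h' : p ^ k * n ≤ n ^ 3 := by
        rw [hn, ← pow_add, ← pow_mul]
        exact Nat.pow_le_pow_right hp.pos (by omega)
      omega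
  · obtain ⟨k'', rfl⟩ : ∃ k'', k' = k'' + 1 := ⟨k' - 1, by omega⟩
    obtain ⟨f₁, hf₁⟩ := exists_hom_of_odd (g := g) (show r = 2 * k'' + 3 by omega) n
    obtain ⟨hord, N, hNle, hNcard, hNav⟩ := prod_trick f₁ f₂ hf₁ hpow
    refine ⟨_, inferInstance, inferInstance, f₁.prod f₂, N, ⟨(k + 1) * 2 + (k + 1) * 3, ?_⟩, hord,
      hNle, ?_, hNav⟩
    · rw [Nat.card_prod, hcZ2, hcZ3, hn, ← pow_mul, ← pow_mul, ← pow_add]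
    · rw [hr2, hcZ2] at hNcard
      by_contra hlt
      rw [not_le] at hlt
      have : Nat.card N * n ^ 2 < p ^ k * n ^ 2 :=
        Nat.mul_lt_mul_of_pos_right hlt (pow_pos (pow_pos hp.pos _) 2)
      have h' : p ^ k * n ^ 2 ≤ n ^ 3 := by
        rw [hn, ← pow_mul, ← pow_add, ← pow_mul]
        exact Nat.pow_le_pow_right hp.pos (by omega)
      omega

end Literature.GroupTheory.CombinatorialGroupTheory.PuncturedSurfaceGroup
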